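import Literature.RepresentationTheory.FiniteGroups.GL2ModularPrincipalSeriesCoordTwist
import HarnessLib

/-!
# The twisting operator on a homothetic copy `ϖᶜ·Fun_R(Ind(χ₁ ⊗ χ₂))` of the standard lattice: torus lines,
# the index `(J(χ₂χ, χ))`, and the divisibility criterion `T_χ(Λ^{T,χ∘det}) ⊆ ϖ·Λ^T ⟹ ϖ ∣ J(χ₂χ, χ)`

Topic `Literature/RepresentationTheory/FiniteGroups`, namespace `Literature.RepresentationTheory.FiniteGroups.GL2`
(sequel of `GL2ModularPrincipalSeriesCoordTwist`; consumer-side complement of the lattice theorem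
`subrepresentation_coordRep_eq_pow_smul_top` of `…LatticeUniqueSubrep`, whose CONCLUSION `Λ = ϖᶜ · ⊤` is taken
here as the hypothesis `hΛ`).  THEOREMS ONLY (no definition, no named fact, no instance, no notation, no `sorry`).

Setting [Bump1997, §4.1; EmertonGeeSavitt2015, §4.1]: `R` a commutative domain, `ϖ ∈ R`, `F` a finite field,
`χ₁ χ₂ : Fˣ → Rˣ` with trivial central character `χ₁χ₂ = 1` and `χ₁ ≠ 1` (the tame type `Ind(η ⊗ η⁻¹)`), `χ` a
quadratic character of `F` with values in `R`, `χ ∉ {χ₁, χ₂}`, and `Λ = ϖᶜ · (Option F → R)` a homothetic copy of the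
standard lattice of the Bruhat-coordinate model `coordRep χ₁ χ₂`.  Then:

* `pow_smul_top_inf_span_singleton`: `(ϖᶜ·⊤) ∩ R·e = R·(ϖᶜ e)` for a vector `e` with a coordinate equal to `1`;
* **`smul_top_inf_coordTorusInvariants`**: `Λ^T := Λ ∩ {T-invariants} = R·(ϖᶜ e_{χ₂})`;
  **`smul_top_inf_coordTorusEigenspace_quadratic`**: `Λ^{T,χ∘det} = R·(ϖᶜ e_{χ₂χ})`;
* **`map_coordTwistOp_latticeTorusEigenspace`**: `T_χ(Λ^{T,χ∘det}) = (χ(−1)J(χ₂χ, χ)) · Λ^T` — the «index of the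
  twisting operator between the torus lines of the lattice» is the principal ideal of the JACOBI SUM `J(χ₂χ, χ)`
  [IrelandRosen1990, Ch. 8 §3];
* **`dvd_jacobiSum_of_map_le_smul`**: if `Λ^{T,χ∘det} ⊆ span S` for a set `S` of vectors with `T_χ(S) ⊆ ϖ·Λ^T`,
  then `ϖ ∣ J(χ₂χ, χ)` — the divisibility criterion by which a unit Jacobi sum EXCLUDES `T_χ(Λ^{T,χ∘det}) ⊆ ϖΛ^T`.
-/

noncomputable section

namespace Literature.RepresentationTheory.FiniteGroups

namespace GL2

open Matrix Finset Pointwise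

section Generic

variable {R : Type*} [CommRing R]

/-- `(a·⊤) ∩ R·e = R·(a e)` in a coordinate module `ι → R` over a domain, for a vector `e` having some coordinate
equal to `1` (then `r e ∈ a·⊤` forces `a ∣ r`). [cite: EmertonGeeSavitt2015, Lemma 4.1.1] -/
theorem smul_top_inf_span_singleton [IsDomain R] {ι : Type*} (e : ι → R) {i₀ : ι} (he : e i₀ = 1) (a : R) :
    (a • (⊤ : Submodule R (ι → R))) ⊓ (R ∙ e) = R ∙ (a • e) := by
  refine le_antisymm ?_ ?_
  · rintro v ⟨hv, hve⟩
    obtain ⟨w, -, rfl⟩ := (Submodule.mem_smul_pointwise_iff_exists _ _ _).mp hv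
    obtain ⟨r, hr⟩ := Submodule.mem_span_singleton.mp hve
    have h0 := congrFun hr i₀
    simp only [Pi.smul_apply, smul_eq_mul, he, mul_one] at h0
    -- `r = a * w i₀`
    refine Submodule.mem_span_singleton.mpr ⟨w i₀, ?_⟩
    rw [← hr, smul_smul, h0, mul_comm]
  · rw [Submodule.span_le, Set.singleton_subset_iff]
    exact ⟨Submodule.smul_mem_pointwise_smul _ _ _ Submodule.mem_top,
      Submodule.smul_mem _ _ (Submodule.mem_span_singleton_self e)⟩

/-- In a coordinate module over a domain: if `b • (a • e) ∈ ϖ • R·(a • e)` with `a ≠ 0` and `e` having a coordinate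
`1`, then `ϖ ∣ b`. [cite: EmertonGeeSavitt2015, Lemma 4.1.1] -/
theorem dvd_of_smul_mem_smul_span_singleton [IsDomain R] {ι : Type*} (e : ι → R) {i₀ : ι} (he : e i₀ = 1)
    {a : R} (ha : a ≠ 0) (ϖ b : R) (h : b • (a • e) ∈ ϖ • (R ∙ (a • e))) : ϖ ∣ b := by
  obtain ⟨w, hw, hbw⟩ := (Submodule.mem_smul_pointwise_iff_exists _ _ _).mp h
  obtain ⟨r, rfl⟩ := Submodule.mem_span_singleton.mp hw
  have h0 := congrFun hbw i₀
  simp only [Pi.smul_apply, smul_eq_mul, he, mul_one] at h0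
  -- `ϖ * (r * a) = b * a`
  refine ⟨r, mul_right_cancel₀ ha ?_⟩
  rw [← h0]
  ring

end Generic

section Lattice

variable {F : Type} [Field F] [Fintype F] [DecidableEq F] {R : Type*} [CommRing R] [IsDomain R]
  (χ₁ χ₂ : Fˣ →* Rˣ)

omit [Fintype F] [DecidableEq F] [IsDomain R] in
/-- The torus vector has the unit coordinate `e_θ(some 1) = θ(1) = 1`. [cite: Bump1997, §4.1 Thm. 4.1.1 (proof)] -/
theorem torusVec_some_one (θ : MulChar F R) : torusVec θ (some 1) = 1 := by
  rw [torusVec_some, map_one]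

omit [Fintype F] in
/-- **The `T`-invariant line of the lattice `ϖᶜ·⊤`** (`χ₁χ₂ = 1`, `χ₁ ≠ 1`):
`(ϖᶜ·⊤) ∩ {w : T·w = w} = R·(ϖᶜ e_{χ₂})`. [cite: Bump1997, §4.1 Thm. 4.1.1 (proof)] -/
theorem smul_top_inf_coordTorusInvariants (h12 : χ₁ * χ₂ = 1) (h1 : χ₁ ≠ 1) (a : R) :
    (a • (⊤ : Submodule R (Option F → R))) ⊓ coordTorusEigenspace χ₁ χ₂ (fun _ _ => (1 : R)) =
      R ∙ (a • torusVec (MulChar.ofUnitHom χ₂)) := by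
  rw [coordTorusInvariants_eq_span χ₁ χ₂ h12 h1,
    smul_top_inf_span_singleton _ (torusVec_some_one (MulChar.ofUnitHom χ₂)) a]

omit [Fintype F] in
/-- **The `χ∘det`-eigen-line of the lattice `ϖᶜ·⊤`** (`χ₁χ₂ = 1`, `χ` quadratic, `χ ∉ {χ₁, χ₂}`):
`(ϖᶜ·⊤) ∩ {w : diag(a,b)·w = χ(ab)w} = R·(ϖᶜ e_{χ₂χ})`. [cite: Bump1997, §4.1 Thm. 4.1.1 (proof)] -/
theorem smul_top_inf_coordTorusEigenspace_quadratic (h12 : χ₁ * χ₂ = 1) {χ : MulChar F R} (hχ : χ⁻¹ = χ)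
    (hχ1 : χ ≠ MulChar.ofUnitHom χ₁) (hχ2 : χ ≠ MulChar.ofUnitHom χ₂) (a : R) :
    (a • (⊤ : Submodule R (Option F → R))) ⊓ coordTorusEigenspace χ₁ χ₂ (fun a b : Fˣ => χ (a : F) * χ (b : F)) =
      R ∙ (a • torusVec (MulChar.ofUnitHom χ₂ * χ)) := by
  rw [coordTorusEigenspace_quadratic_eq_span χ₁ χ₂ h12 hχ hχ1 hχ2,
    smul_top_inf_span_singleton _ (torusVec_some_one (MulChar.ofUnitHom χ₂ * χ)) a]

/-- **The twisting operator between the torus lines of the lattice `Λ = ϖᶜ·⊤`:**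
`T_χ(Λ ∩ 𝓑^{T,χ∘det}) = (χ(−1)·J(χ₂χ, χ)) · (Λ ∩ 𝓑^T)` — the image of the `χ∘det`-line of `Λ` is the Jacobi-sum
multiple of its `T`-invariant line. [cite: IrelandRosen1990, Ch. 8 §3 Thm. 1] -/
theorem map_coordTwistOp_latticeTorusEigenspace (h12 : χ₁ * χ₂ = 1) (h1 : χ₁ ≠ 1) {χ : MulChar F R}
    (hχ : χ⁻¹ = χ) (hχ1 : χ ≠ MulChar.ofUnitHom χ₁) (hχ2 : χ ≠ MulChar.ofUnitHom χ₂) (a : R) :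
    ((a • (⊤ : Submodule R (Option F → R))) ⊓
        coordTorusEigenspace χ₁ χ₂ (fun a b : Fˣ => χ (a : F) * χ (b : F))).map (coordTwistOp χ₁ χ₂ χ) =
      (χ (-1) * jacobiSum (MulChar.ofUnitHom χ₂ * χ) χ) •
        ((a • (⊤ : Submodule R (Option F → R))) ⊓ coordTorusEigenspace χ₁ χ₂ (fun _ _ => (1 : R))) := by
  have hχχ : χ * χ = 1 := by
    nth_rw 1 [← hχ]
    exact inv_mul_cancel χ
  have hne : MulChar.ofUnitHom χ₂ * χ * χ ≠ 1 := by
    rw [mul_assoc, hχχ, mul_one]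
    exact ofUnitHom_ne_one χ₁ χ₂ h12 h1
  rw [smul_top_inf_coordTorusEigenspace_quadratic χ₁ χ₂ h12 hχ hχ1 hχ2, smul_top_inf_coordTorusInvariants χ₁ χ₂ h12 h1,
    Submodule.map_span, Set.image_singleton, map_smul, coordTwistOp_torusVec χ₁ χ₂ χ _ hne, mul_assoc, hχχ, mul_one,
    Submodule.smul_span, Set.smul_set_singleton, smul_comm]

/-- **Divisibility criterion.**  In the setting of `map_coordTwistOp_latticeTorusEigenspace`, suppose the
`χ∘det`-line of `Λ = ϖᶜ·⊤` lies in the `R`-span of a set `S` of vectors each of which is carried by `T_χ` into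
`ϖ·(Λ ∩ 𝓑^T)`.  Then `ϖ ∣ J(χ₂χ, χ)`.  (Contrapositive: a UNIT Jacobi sum forbids `T_χ(Λ^{T,χ∘det}) ⊆ ϖ·Λ^T`; for
`p`-adic Teichmüller powers this is Stickelberger's dichotomy.) [cite: IrelandRosen1990, Ch. 8 §3 Thm. 1] -/
theorem dvd_jacobiSum_of_span_le_of_map_mem (h12 : χ₁ * χ₂ = 1) (h1 : χ₁ ≠ 1) {χ : MulChar F R}
    (hχ : χ⁻¹ = χ) (hχ1 : χ ≠ MulChar.ofUnitHom χ₁) (hχ2 : χ ≠ MulChar.ofUnitHom χ₂) {a : R} (ha : a ≠ 0) (ϖ : R)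
    (S : Set (Option F → R))
    (hS : (a • (⊤ : Submodule R (Option F → R))) ⊓
        coordTorusEigenspace χ₁ χ₂ (fun a b : Fˣ => χ (a : F) * χ (b : F)) ≤ Submodule.span R S)
    (hT : ∀ v ∈ S, coordTwistOp χ₁ χ₂ χ v ∈
        ϖ • ((a • (⊤ : Submodule R (Option F → R))) ⊓ coordTorusEigenspace χ₁ χ₂ (fun _ _ => (1 : R)))) :
    ϖ ∣ jacobiSum (MulChar.ofUnitHom χ₂ * χ) χ := by
  set LT := (a • (⊤ : Submodule R (Option F → R))) ⊓ coordTorusEigenspace χ₁ χ₂ (fun _ _ => (1 : R)) with hLT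
  set J := χ (-1) * jacobiSum (MulChar.ofUnitHom χ₂ * χ) χ with hJ
  -- `J • LT = T(Λ^{T,χ}) ⊆ T(span S) ⊆ ϖ • LT`
  have hle : J • LT ≤ ϖ • LT := by
    rw [hJ, hLT, ← map_coordTwistOp_latticeTorusEigenspace χ₁ χ₂ h12 h1 hχ hχ1 hχ2 a]
    refine (Submodule.map_mono hS).trans ?_
    rw [Submodule.map_span, Submodule.span_le]
    rintro _ ⟨v, hv, rfl⟩
    exact hT v hv
  -- read it on the generator `a • e_{χ₂}`
  have hmem : J • (a • torusVec (MulChar.ofUnitHom χ₂)) ∈ ϖ • (R ∙ (a • torusVec (MulChar.ofUnitHom χ₂))) := by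
    rw [← smul_top_inf_coordTorusInvariants χ₁ χ₂ h12 h1 a, ← hLT]
    exact hle (Submodule.smul_mem_pointwise_smul _ _ _
      (by rw [hLT, smul_top_inf_coordTorusInvariants χ₁ χ₂ h12 h1 a]; exact Submodule.mem_span_singleton_self _))
  have hdvd : ϖ ∣ J :=
    dvd_of_smul_mem_smul_span_singleton _ (torusVec_some_one (MulChar.ofUnitHom χ₂)) ha ϖ J hmem
  -- `χ(−1)` is a unit
  have hunit : IsUnit (χ (-1)) := by
    have h := MulChar.coe_toUnitHom χ (-1)
    rw [Units.val_neg, Units.val_one] at h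
    rw [← h]
    exact Units.isUnit _
  exact hunit.dvd_mul_left.mp hdvd

end Lattice

end GL2

end Literature.RepresentationTheory.FiniteGroups
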